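import Mathlib.MeasureTheory.Constructions.BorelSpace.Metrizable
import Literature.Probability.RandomPlanarGeometry.NestingTransform
import Literature.Probability.Percolation.FKLoopNestingMeasurable
import Literature.Probability.Percolation.FullPlaneCNL
import HarnessLib

/-!
# Measurability of the `cos_μ`-nesting weights of the lattice loop ensembles (bond `ℤ²`, site `𝕋`)

The truncated and untruncated loop functionals of
`Literature.Probability.RandomPlanarGeometry.NestingTransform`
(`LoopConfig.nestingWeight f c = ∏ᶠ_{u ∈ c.loops} 2cos(∫_{int u} f + π/3)`,
`LoopConfig.truncNestingWeight f ε c`, the product over the loops of trace-diameter `≥ ε`) are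
Bochner-integrated in the consumer statements (`MagicFormulaZ2`, `MagicFormulaT`,
`TransferContinuity` of route `CardyMagicRigidity`; `truncNestingTransform`). This file proves that
they are **measurable** random variables on both lattice probability spaces, at every mesh:

* `measurable_finprod_mem_of_subset_range` — the general principle behind
  `measurable_loopNestingWeight` (`FKLoopNestingMeasurable`), isolated: if a random set `S ω` is
  always contained in the range of a map from a COUNTABLE index type and every membership event
  `{ω | a ∈ S ω}` is measurable, then `ω ↦ ∏ᶠ_{a ∈ S ω} g a` is measurable for every real `g`
  (pointwise limit of finite products of simple functions; the junk value `1` of an infinite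
  product is reproduced by the approximants);
* bond `ℤ²` (`bondLoopConfig δ 0`, index = nonempty dart lists, `mem_loops_iff`):
  `measurable_nestingWeight_bondLoopConfig`, `measurable_truncNestingWeight_bondLoopConfig`;
* site `𝕋` (`siteLoopConfig δ`, index = closed honeycomb walks, `gen_siteLoopConfig`,
  `countable_sigma_hexLoop`): `measurable_mem_loops_siteLoopConfig`,
  `measurable_nestingWeight_siteLoopConfig`, `measurable_truncNestingWeight_siteLoopConfig`.

Integrability (boundedness at fixed mesh) is in `FKLoopNestingIntegrable` for the bond side; the
site side is not treated here.

## References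

* H. Duminil-Copin, K. K. Kozlowski, P. Lammers, I. Manolescu, arXiv:2603.06268 (2026), §3.2,
  (5.4) (the loop functional `A_φ`).
* F. Camia, C. M. Newman, Comm. Math. Phys. 268 (2006), §2.2 (loop laws are Borel measures).
-/

noncomputable section

open MeasureTheory Set Filter Metric Function
open scoped Real Topology

namespace Literature.Probability.Percolation

open LatticeModels RandomPlanarGeometry

/-! ### Finite products over countably generated random sets are measurable -/

/-- **Measurability of `ω ↦ ∏ᶠ_{a ∈ S ω} g a`** for a random set `S ω ⊆ range U`, `U` defined on
a countable index type, with measurable membership events: the `finprod` is the pointwise limit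
of the measurable approximants "product over the first `n` indices if they exhaust the
contributing members, else `1`". [folklore] -/
theorem measurable_finprod_mem_of_subset_range {Ω α K : Type*} [MeasurableSpace Ω] [Countable K]
    (U : K → α) {S : Ω → Set α} (hSU : ∀ ω, S ω ⊆ Set.range U)
    (hS : ∀ a, Measurable fun ω ↦ a ∈ S ω) (g : α → ℝ) :
    Measurable fun ω ↦ ∏ᶠ a ∈ S ω, g a := by
  classical
  rcases isEmpty_or_nonempty K with hK | hK
  · -- no indices: every `S ω` is empty
    have h1 : ∀ ω, ∏ᶠ a ∈ S ω, g a = 1 := fun ω ↦ by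
      rw [Set.eq_empty_of_subset_empty ((hSU ω).trans (by simp [Set.range_eq_empty])),
        finprod_mem_empty]
    simp only [h1]
    exact measurable_const
  obtain ⟨e, he⟩ := exists_surjective_nat K
  set T : ℕ → Finset α := fun n ↦ (Finset.range n).image fun k ↦ U (e k) with hT
  set V : ℕ → Ω → ℝ := fun n ω ↦
    if (∀ k, U (e k) ∈ S ω → g (U (e k)) ≠ 1 → U (e k) ∈ T n) then
      ∏ u ∈ T n, (if u ∈ S ω then g u else 1) else 1 with hV
  -- every member is some `U (e k)`
  have hSU' : ∀ ω, ∀ u ∈ S ω, ∃ k, U (e k) = u := by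
    intro ω u hu
    obtain ⟨k', rfl⟩ := hSU ω hu
    obtain ⟨k, rfl⟩ := he k'
    exact ⟨k, rfl⟩
  have hVmeas : ∀ n, Measurable (V n) := by
    intro n
    refine Measurable.ite ?_ ?_ measurable_const
    · exact measurableSet_setOf.2
        (Measurable.forall fun k ↦ (hS _).imp (measurable_const.imp measurable_const))
    · refine Finset.measurable_prod _ fun u _ ↦ ?_
      exact Measurable.ite (measurableSet_setOf.2 (hS u)) measurable_const measurable_const
  have hprod : ∀ ω n, S ω ∩ mulSupport g ⊆ ↑(T n) →
      ∏ u ∈ T n, (if u ∈ S ω then g u else 1) = ∏ᶠ u ∈ S ω, g u := by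
    intro ω n hsub
    rw [finprod_mem_def, finprod_eq_prod_of_mulSupport_subset _ (by rwa [mulSupport_mulIndicator])]
    exact Finset.prod_congr rfl fun u _ ↦ (Set.mulIndicator_apply (S ω) g u).symm
  have hlim : ∀ ω, Tendsto (fun n ↦ V n ω) atTop (𝓝 (∏ᶠ u ∈ S ω, g u)) := by
    intro ω
    by_cases hfin : (S ω ∩ mulSupport g).Finite
    · set idx : α → ℕ := fun u ↦ if h : ∃ k, U (e k) = u then Nat.find h else 0 with hidx
      have hidx_spec : ∀ u ∈ S ω, U (e (idx u)) = u := by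
        intro u hu
        have h := hSU' ω u hu
        have hi : idx u = Nat.find h := by simp only [hidx, dif_pos h]
        rw [hi]
        exact Nat.find_spec h
      obtain ⟨m, hm⟩ := (hfin.image idx).bddAbove
      have hsub : ∀ n, m + 1 ≤ n → S ω ∩ mulSupport g ⊆ ↑(T n) := by
        intro n hn u hu
        have hk : idx u ≤ m := hm (Set.mem_image_of_mem idx hu)
        rw [hT, Finset.coe_image]
        exact ⟨idx u, by simp only [Finset.coe_range, Set.mem_Iio]; omega, hidx_spec u hu.1⟩
      refine tendsto_atTop_of_eventually_const (i₀ := m + 1) fun n hn ↦ ?_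
      have hcond : ∀ k, U (e k) ∈ S ω → g (U (e k)) ≠ 1 → U (e k) ∈ T n :=
        fun k hk hgk ↦ hsub n hn ⟨hk, hgk⟩
      rw [hV]
      dsimp only
      rw [if_pos hcond]
      exact hprod ω n (hsub n hn)
    · have hW1 : ∏ᶠ u ∈ S ω, g u = 1 := by
        rw [finprod_mem_def]
        exact finprod_of_infinite_mulSupport (by rwa [mulSupport_mulIndicator])
      have hV1 : ∀ n, V n ω = 1 := by
        intro n
        rw [hV]
        dsimp only
        rw [if_neg]
        intro hcond
        apply hfin
        refine (T n).finite_toSet.subset fun u hu ↦ ?_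
        obtain ⟨k, rfl⟩ := hSU' ω u hu.1
        exact hcond k hu.1 hu.2
      rw [hW1]
      simp only [hV1]
      exact tendsto_const_nhds
  exact measurable_of_tendsto_metrizable hVmeas (tendsto_pi_nhds.2 hlim)

/-- Truncation keeps measurable membership: `{ω | a ∈ bigLoops ε (X ω)}` is measurable when
`{ω | a ∈ (X ω).loops}` is. [folklore] -/
theorem measurable_mem_bigLoops {Ω : Type*} [MeasurableSpace Ω] {X : Ω → LoopConfig ℂ}
    (hX : ∀ u, Measurable fun ω ↦ u ∈ (X ω).loops) (ε : ℝ) (u : UnbasedLoop ℂ) :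
    Measurable fun ω ↦ u ∈ (X ω).bigLoops ε :=
  (hX u).and measurable_const

/-! ### Bond percolation on `δℤ²` -/

/-- The loops of `bondLoopConfig δ 0 ω` are polylines of nonempty dart lists. [folklore] -/
theorem loops_bondLoopConfig_subset_range (δ : ℝ) (ω : BondConfig (Site 2)) :
    (bondLoopConfig δ 0 ω).loops ⊆ Set.range fun k : {γ : List MedialVertex // γ ≠ []} ↦
      UnbasedLoop.mk (BasedLoop.mk (loopCurve δ 0 k.1) (isLoop_loopCurve δ 0 k.2)) := by
  intro u hu
  obtain ⟨k, -, hk⟩ := (mem_loops_iff δ ω u).1 hu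
  exact ⟨k, hk⟩

/-- **The nesting weight `ω ↦ A_f(bondLoopConfig δ 0 ω)` is measurable** on `BondConfig (Site 2)`,
for every density `f` and mesh `δ`. [cite: DuminilCopinKozlowskiLammersManolescu2026, (5.4)] -/
theorem measurable_nestingWeight_bondLoopConfig (f : ℂ → ℝ) (δ : ℝ) :
    Measurable fun ω : BondConfig (Site 2) ↦ (bondLoopConfig δ 0 ω).nestingWeight f :=
  measurable_finprod_mem_of_subset_range _ (loops_bondLoopConfig_subset_range δ)
    (measurable_mem_loops δ) _

/-- **The truncated nesting weight `ω ↦ A^ε_f(bondLoopConfig δ 0 ω)` is measurable.**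
[cite: DuminilCopinKozlowskiLammersManolescu2026, §5 p. 37] -/
theorem measurable_truncNestingWeight_bondLoopConfig (f : ℂ → ℝ) (ε δ : ℝ) :
    Measurable fun ω : BondConfig (Site 2) ↦ (bondLoopConfig δ 0 ω).truncNestingWeight f ε :=
  measurable_finprod_mem_of_subset_range _
    (fun ω ↦ (LoopConfig.bigLoops_subset_loops ε _).trans (loops_bondLoopConfig_subset_range δ ω))
    (measurable_mem_bigLoops (measurable_mem_loops δ) ε) _

/-! ### Site percolation on `δ𝕋` -/

/-- The loops of `siteLoopConfig δ ω` (both types) are the polygons of closed honeycomb walks that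
are interface loops of `ω`. [folklore] -/
theorem mem_loops_siteLoopConfig_iff (δ : ℝ) (ω : SiteConfig (Site 2)) (u : UnbasedLoop ℂ) :
    u ∈ (siteLoopConfig δ ω).loops ↔ ∃ k : Σ v : HexVertex, hexGraph.Walk v v,
      IsSiteInterfaceLoop ω k.2 ∧
        UnbasedLoop.mk (BasedLoop.mk (siteLoopCurve δ k.2) (isLoop_siteLoopCurve δ k.2)) = u := by
  rw [LoopConfig.mem_loops_iff, gen_siteLoopConfig δ ω 0 u, gen_siteLoopConfig δ ω 1 u]
  constructor
  · rintro (⟨k, ⟨h, -⟩, hk⟩ | ⟨k, ⟨h, -⟩, hk⟩) <;> exact ⟨k, h, hk⟩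
  · rintro ⟨k, h, hk⟩
    by_cases hs : 0 < shoelace (k.2.support.map hexCenter)
    · exact Or.inr ⟨k, ⟨h, ⟨fun _ ↦ hs, fun _ ↦ rfl⟩⟩, hk⟩
    · exact Or.inl ⟨k, ⟨h, ⟨fun h0 ↦ absurd h0 (by decide), fun h' ↦ absurd h' hs⟩⟩, hk⟩

/-- The loops of `siteLoopConfig δ ω` are polygons of closed honeycomb walks. [folklore] -/
theorem loops_siteLoopConfig_subset_range (δ : ℝ) (ω : SiteConfig (Site 2)) :
    (siteLoopConfig δ ω).loops ⊆ Set.range fun k : (Σ v : HexVertex, hexGraph.Walk v v) ↦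
      UnbasedLoop.mk (BasedLoop.mk (siteLoopCurve δ k.2) (isLoop_siteLoopCurve δ k.2)) := by
  intro u hu
  obtain ⟨k, -, hk⟩ := (mem_loops_siteLoopConfig_iff δ ω u).1 hu
  exact ⟨k, hk⟩

/-- **"`u` is an interface loop of `ω` on `δ𝕋`" is a measurable event** (countable union over the
closed walks with polygon `u` of the events `measurable_isSiteInterfaceLoop`). [folklore] -/
theorem measurable_mem_loops_siteLoopConfig (δ : ℝ) (u : UnbasedLoop ℂ) :
    Measurable fun ω : SiteConfig (Site 2) ↦ u ∈ (siteLoopConfig δ ω).loops := by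
  haveI := countable_sigma_hexLoop
  simp only [mem_loops_siteLoopConfig_iff]
  exact Measurable.exists fun k ↦ (measurable_isSiteInterfaceLoop k.2).and measurable_const

/-- **The nesting weight `ω ↦ A_f(siteLoopConfig δ ω)` is measurable** on `SiteConfig (Site 2)`,
for every density `f` and mesh `δ` (the integrand of `MagicFormulaT`).
[cite: DuminilCopinKozlowskiLammersManolescu2026, (5.4)] -/
theorem measurable_nestingWeight_siteLoopConfig (f : ℂ → ℝ) (δ : ℝ) :
    Measurable fun ω : SiteConfig (Site 2) ↦ (siteLoopConfig δ ω).nestingWeight f := by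
  haveI := countable_sigma_hexLoop
  exact measurable_finprod_mem_of_subset_range _ (loops_siteLoopConfig_subset_range δ)
    (measurable_mem_loops_siteLoopConfig δ) _

/-- **The truncated nesting weight `ω ↦ A^ε_f(siteLoopConfig δ ω)` is measurable.**
[cite: DuminilCopinKozlowskiLammersManolescu2026, §5 p. 37] -/
theorem measurable_truncNestingWeight_siteLoopConfig (f : ℂ → ℝ) (ε δ : ℝ) :
    Measurable fun ω : SiteConfig (Site 2) ↦ (siteLoopConfig δ ω).truncNestingWeight f ε := by
  haveI := countable_sigma_hexLoop
  exact measurable_finprod_mem_of_subset_range _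
    (fun ω ↦ (LoopConfig.bigLoops_subset_loops ε _).trans (loops_siteLoopConfig_subset_range δ ω))
    (measurable_mem_bigLoops (measurable_mem_loops_siteLoopConfig δ) ε) _

end Literature.Probability.Percolation

end
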